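import Literature.Analysis.InnerProduct.LensWeightsEquivalenceRelation
import Mathlib.LinearAlgebra.Pi
import HarnessLib

/-!
# Isometric lens spaces ⟺ `‖·‖₁`-isometric congruence lattices (Lauret–Miatello–Rossetti, Proposition 3.3), and:
# a `‖·‖₁`-preserving linear map of `ℤⁿ` is a signed permutation

Layer `Literature/Analysis/InnerProduct`, namespace `Literature.Analysis.InnerProduct`; lane `lit-hodgefound` (Track 2 foundations
library), prover seat `lit-hodgefound-p06`, generation 47, self-proposed row g47-#2 — the companion of row g47-#1
(`HigherLensSpaceOneNormLattice.lean`: isospectral ⟺ `‖·‖₁`-isospectral congruence lattices). THEOREMS ONLY (no definition, no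
instance, no notation, no named fact). Vocabulary: "`L(q; p)` and `L(q; s)` are isometric" IS the tree's `LensWeightsEquivalent q p s`
(`HigherLensSpaceMultiplicity.lean`: "there is a number `l` and there are numbers `eᵢ ∈ {−1, 1}` such that `(p₁, …, p_n)` is a
permutation of `(e₁ls₁, …, e_nls_n) (mod q)`" — Ikeda's Theorem 2.1 (4) = LMR's Proposition 3.1); the congruence lattice `𝓛(q; s) =
{a ∈ ℤⁿ : q ∣ ∑aᵢsᵢ}` enters through its membership predicate, and "`𝓛(q; s)` and `𝓛(q; p)` are `‖·‖₁`-isometric" is written as: there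
is a `ℤ`-linear automorphism `φ` of `ℤⁿ = (Fin n → ℤ)` preserving the one-norm `∑ᵢ|aᵢ|` (`Int.natAbs`) with `a ∈ 𝓛(q; s) ↔ φ(a) ∈
𝓛(q; p)` for all `a` (i.e. `φ(𝓛(q; s)) = 𝓛(q; p)`; LMR let `φ` be a `‖·‖₁`-linear isometry of `ℝⁿ` carrying one lattice onto the other —
by §1 such a map is a signed permutation, so it preserves `ℤⁿ`, and the two readings agree).

## Source, verbatim (held text `paper:arxiv-1311.7167` = the arXiv version of LauretMiatelloRossetti2015, p0007)

E. A. Lauret, R. J. Miatello, J. P. Rossetti, *Spectra of lens spaces from 1-norm spectra of congruence lattices*, IMRN 2016, §3: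
"**Proposition 3.1.** Let `L = L(q; s)` and `L' = L(q; s')` be lens spaces. Then the following assertions are equivalent. `L` is
isometric to `L'`. … There exist `σ` a permutation of `{1, …, m}`, `ε₁, …, ε_m ∈ {±1}` and `t ∈ ℤ` coprime to `q` such that
`s'_{σ(j)} ≡ tε_js_j (mod q)` for all `1 ≤ j ≤ m`. … **Definition 3.2.** Let `q ∈ ℕ` and `s = (s₁, …, s_m) ∈ ℤ^m` such that each
entry `s_j` is coprime to `q`. We associate to the lens space `L(q; s)` the congruence lattice `𝓛(q; s₁, …, s_m) = {(a₁, …, a_m) ∈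
ℤ^m : a₁s₁ + ⋯ + a_ms_m ≡ 0 (mod q)}`. For `μ = (a₁, …, a_m) ∈ ℤ^m`, we set `‖μ‖₁ = ∑_{j=1}^m |a_j|`. **Proposition 3.3.** Let `L(q; s)`,
`L(q; s')` be lens spaces with `𝓛(q, s)` and `𝓛(q, s')` the associated lattices. Then, `L(q; s)` and `L(q; s')` are isometric if and
only if `𝓛(q; s)` and `𝓛(q; s')` are `‖·‖₁`-isometric. *Proof.* By Proposition 3.1, `L` and `L'` are isometric if and only if there
exist `t` coprime to `q` and `φ`, a composition of permutations and changes of signs, such that `φ(ts) = φ(ts₁, …, ts_m) = (s'₁, …,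
s'_m) = s'`. Hence `𝓛(q, s') = 𝓛(q, φ(s)) = φ(𝓛(q, s))` with `φ` a `‖·‖₁`-isometry. In order to prove the converse assertion, we
first show that every `‖·‖₁`-linear isometry of `ℝⁿ` is a composition of permutations and changes of signs. If `T` is a
`‖·‖₁`-linear isometry of `ℝⁿ`, then for each `1 ≤ k ≤ n`, `T(ε_k) = ∑_{j=1}^n c_{k,j}ε_j` with `∑|c_{k,j}| = 1`. We claim that
`c_{k,j} ≠ 0` for at most one value of `j`. Otherwise, there are `h, k, ℓ` such that `c_{k,ℓ}c_{h,ℓ} ≠ 0`. Hence `|c_{k,ℓ} + δc_{h,ℓ}|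
< |c_{k,ℓ}| + |c_{h,ℓ}|`, for `δ = 1` or `δ = −1`. Thus, for this choice of `δ` we have `2 = ‖T(ε_k) + δT(ε_h)‖₁ = ∑_{j=1}^n |c_{k,j}
+ δc_{h,j}| < ∑_{j=1}^n |c_{k,j}| + |c_{h,j}| = 2`, a contradiction. Now, suppose conversely that `φ` is a `‖·‖₁`-isometry between
`𝓛(q, s)` and `𝓛(q, s')`. The previous paragraph ensures that `φ` is given by `φ(a₁, …, a_m) = (ε_{σ(1)}a_{σ(1)}, …, ε_{σ(m)}a_{σ(m)})`
with `σ` a permutation of `{1, …, m}` and `ε_j = ±1` for all `j`, and satisfies `𝓛(q; s') = φ(𝓛(q; s))`, thus `𝓛(q; s') = 𝓛(q;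
φ(s))`. For each `2 ≤ j ≤ m`, the vector `(−s'_j, 0, …, 0, s'₁, 0, …, 0)` lies in `𝓛(q; s')`, thus `−s'_jε_{σ(1)}s_{σ(1)} +
s'₁ε_{σ(j)}s_{σ(j)} ≡ 0 (mod q)` since it is also in `𝓛(q; φ(s))`. Then, if `t ∈ ℤ` is such that `tε_{σ(1)}s_{σ(1)} ≡ s'₁ (mod q)`,
one has that `s'_j ≡ tε_{σ(j)}s_{σ(j)} (mod q)` for every `j`. Hence `L` and `L'` are isometric to each other."

## The proof, as formalised

§1 is the "previous paragraph" over `ℤ`: for a `ℤ`-linear `f : ℤⁿ → ℤⁿ` with `‖f(a)‖₁ = ‖a‖₁` for all `a`, `‖f(e_k)‖₁ = 1` forces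
`f(e_k) = ε_ke_{τ(k)}` with `ε_k = ±1` (over `ℤ` a vector of one-norm `1` is `±` a basis vector), and `τ` is injective because for
`τ(k) = τ(h)`, `k ≠ h`, the vector `a = ε_he_k − ε_ke_h` has `f(a) = 0` but `‖a‖₁ = 2` (LMR's `δ`); so `τ` is a permutation `σ`
and `f(a)_{σ(i)} = ε_ia_i` (`exists_perm_sign_of_linearMap_oneNorm_eq`; no injectivity or surjectivity of `f` is assumed). §2, (⇒):
from `p_{σ(i)} ≡ e_ils_i` the signed permutation `φ(a)_{σ(i)} = e_ia_i` is a one-norm-preserving automorphism with `∑_jφ(a)_jp_j ≡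
l∑_ia_is_i (mod q)`, and `l` is prime to `q` when the `p_i` are (the tree's `LensWeightsEquivalent.symm` argument), so `a ∈ 𝓛(q; s)
↔ φ(a) ∈ 𝓛(q; p)` (`LensWeightsEquivalent.exists_linearEquiv_oneNorm`). (⇐): with `φ(a)_{σ(i)} = ε_ia_i` from §1, LMR's vectors
`a = s_{i₀}e_j − s_je_{i₀} ∈ 𝓛(q; s)` give `ε_js_{i₀}p_{σ(j)} ≡ ε_{i₀}s_jp_{σ(i₀)}`, and with `us_{i₀} ≡ 1` (`s_{i₀}` prime to `q`)
`p_{σ(j)} ≡ ε_j(uε_{i₀}p_{σ(i₀)})s_j`, i.e. `LensWeightsEquivalent q p s` with `l = uε_{i₀}p_{σ(i₀)}` — only the inclusion `φ(𝓛(q;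
s)) ⊆ 𝓛(q; p)` is used (`lensWeightsEquivalent_of_linearMap_oneNorm`). §3 assembles PROPOSITION 3.3 and records that
`‖·‖₁`-isometric congruence lattices are `‖·‖₁`-isospectral (`φ` restricts to bijections of the one-norm shells), the elementary
half of "isometric ⟹ isospectral" in the language of row g47-#1.

## What is proved

* §1 `exists_eq_single_of_sum_natAbs_eq_one` (a vector of one-norm `1` in `ℤⁿ` is `±e_j`), **`exists_perm_sign_of_linearMap_oneNorm_eq`**
  (a one-norm-preserving `ℤ`-linear endomorphism of `ℤⁿ` is a signed permutation: `f(a)_{σ(i)} = ε_ia_i`).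
* §2 **`LensWeightsEquivalent.exists_linearEquiv_oneNorm`** (⇒ of Proposition 3.3), **`lensWeightsEquivalent_of_linearMap_oneNorm`** (⇐,
  from a one-norm-preserving linear map with `φ(𝓛(q; s)) ⊆ 𝓛(q; p)`, weights `s_i` prime to `q`).
* §3 **`lensWeightsEquivalent_iff_exists_linearEquiv_oneNorm`** (PROPOSITION 3.3), `card_oneNorm_congruenceLattice_eq_of_linearEquiv`
  (`‖·‖₁`-isometric lattices have the same one-norm counts `N_𝓛(k)`, all `k`).

## References

* [LauretMiatelloRossetti2015] E. A. Lauret, R. J. Miatello, J. P. Rossetti, *Spectra of lens spaces from 1-norm spectra of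
  congruence lattices*, Int. Math. Res. Not. IMRN 2016 (4) 1054–1089 (arXiv:1311.7167: Proposition 3.1, Definition 3.2,
  Proposition 3.3 with its proof).
* [Ikeda1980] A. Ikeda, *On lens spaces which are isospectral but not isometric*, Ann. Sci. ÉNS (4) 13 (1980) 303–315, Theorem 2.1
  (the isometry criterion `LensWeightsEquivalent`).
-/

namespace Literature.Analysis.InnerProduct

open Finset

/-! ### §1 One-norm-preserving linear maps of `ℤⁿ` are signed permutations -/

/-- A vector `c ∈ ℤⁿ` of one-norm `∑_j|c_j| = 1` is `±e_{j₀}`: one coordinate is `±1` and the others vanish ("`T(ε_k) =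
∑_j c_{k,j}ε_j` with `∑|c_{k,j}| = 1`. We claim that `c_{k,j} ≠ 0` for at most one value of `j`" — immediate over `ℤ`).
[cite: LauretMiatelloRossetti2015, proof of Proposition 3.3] -/
theorem exists_eq_single_of_sum_natAbs_eq_one {n : ℕ} (c : Fin n → ℤ) (h : ∑ j, (c j).natAbs = 1) :
    ∃ j₀, (c j₀ = 1 ∨ c j₀ = -1) ∧ ∀ j, j ≠ j₀ → c j = 0 := by
  have hne : ∑ j, (c j).natAbs ≠ 0 := by
    rw [h]
    exact one_ne_zero
  obtain ⟨j₀, -, hj₀⟩ := Finset.exists_ne_zero_of_sum_ne_zero hne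
  have hrest : ∀ j, j ≠ j₀ → c j = 0 := by
    intro j hj
    have h2 : (c j₀).natAbs + (c j).natAbs ≤ ∑ i, (c i).natAbs := by
      rw [← Finset.sum_pair (f := fun i ↦ (c i).natAbs) (Ne.symm hj)]
      exact Finset.sum_le_sum_of_subset_of_nonneg (Finset.subset_univ _) fun i _ _ ↦ Nat.zero_le _
    have : (c j).natAbs = 0 := by omega
    exact Int.natAbs_eq_zero.mp this
  have h1 : (c j₀).natAbs = 1 := by
    have hle : (c j₀).natAbs ≤ ∑ i, (c i).natAbs :=
      Finset.single_le_sum (f := fun i ↦ (c i).natAbs) (fun i _ ↦ Nat.zero_le _) (Finset.mem_univ j₀)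
    omega
  exact ⟨j₀, Int.natAbs_eq_iff.mp h1 |>.imp id (by intro h; simpa using h), hrest⟩

/-- The one-norm of the basis vector `e_k = Pi.single k 1 ∈ ℤⁿ` is `1`. [folklore] -/
private theorem sum_natAbs_single {n : ℕ} (k : Fin n) : ∑ j, (Pi.single (M := fun _ ↦ ℤ) k 1 j).natAbs = 1 := by
  classical
  rw [Finset.sum_eq_single k (fun j _ hj ↦ by simp [hj]) (fun h ↦ absurd (Finset.mem_univ k) h)]
  simp

/-- **Every `‖·‖₁`-preserving `ℤ`-linear map `f : ℤⁿ → ℤⁿ` is a signed permutation**: there are a permutation `σ` and signs `ε_i =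
±1` with `f(a)_{σ(i)} = ε_ia_i` for all `a` and `i` ("every `‖·‖₁`-linear isometry of `ℝⁿ` is a composition of permutations and
changes of signs … for this choice of `δ` we have `2 = ‖T(ε_k) + δT(ε_h)‖₁ = ⋯ < 2`, a contradiction"; over `ℤ`, and for a linear
map that is merely norm-preserving). [cite: LauretMiatelloRossetti2015, proof of Proposition 3.3] -/
theorem exists_perm_sign_of_linearMap_oneNorm_eq {n : ℕ} (f : (Fin n → ℤ) →ₗ[ℤ] (Fin n → ℤ))
    (hf : ∀ a, ∑ i, (f a i).natAbs = ∑ i, (a i).natAbs) :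
    ∃ σ : Equiv.Perm (Fin n), ∃ ε : Fin n → ℤ, (∀ i, ε i = 1 ∨ ε i = -1) ∧ ∀ a i, f a (σ i) = ε i * a i := by
  classical
  have hsingle : ∀ k : Fin n, (fun j ↦ if k = j then (1 : ℤ) else 0) = Pi.single k 1 := by
    intro k
    funext j
    rcases eq_or_ne j k with rfl | hj
    · simp
    · rw [Pi.single_eq_of_ne hj, if_neg (Ne.symm hj)]
  -- `f(e_k) = ε_k e_{τ k}`
  have hek : ∀ k : Fin n, ∃ j₀, (f (Pi.single k 1) j₀ = 1 ∨ f (Pi.single k 1) j₀ = -1) ∧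
      ∀ j, j ≠ j₀ → f (Pi.single k 1) j = 0 := fun k ↦
    exists_eq_single_of_sum_natAbs_eq_one _ (by rw [hf, sum_natAbs_single])
  choose τ hτ using hek
  -- `τ` is injective: for `τ k = τ h`, `k ≠ h`, the vector `ε_h e_k − ε_k e_h` is killed by `f` but has one-norm `2`
  have hinj : Function.Injective τ := by
    intro k h hkh
    by_contra hne
    set a : Fin n → ℤ := f (Pi.single h 1) (τ h) • Pi.single k 1 - f (Pi.single k 1) (τ k) • Pi.single h 1 with ha
    have hfa : ∀ j, f a j = 0 := by
      intro j
      rw [ha, map_sub, map_smul, map_smul, Pi.sub_apply, Pi.smul_apply, Pi.smul_apply, smul_eq_mul, smul_eq_mul]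
      by_cases hj : j = τ k
      · rw [hj, hkh]
        ring
      · rw [(hτ k).2 j hj, (hτ h).2 j (hkh ▸ hj), mul_zero, mul_zero, sub_zero]
    have h0 : ∑ j, (f a j).natAbs = 0 := Finset.sum_eq_zero fun j _ ↦ by rw [hfa j, Int.natAbs_zero]
    have hak : (a k).natAbs = 1 := by
      rw [ha, Pi.sub_apply, Pi.smul_apply, Pi.smul_apply, smul_eq_mul, smul_eq_mul, Pi.single_eq_same,
        Pi.single_eq_of_ne hne, mul_zero, sub_zero, mul_one]
      rcases (hτ h).1 with h1 | h1 <;> simp [h1]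
    have hle : (a k).natAbs ≤ ∑ j, (a j).natAbs :=
      Finset.single_le_sum (f := fun j ↦ (a j).natAbs) (fun j _ ↦ Nat.zero_le _) (Finset.mem_univ k)
    rw [hf a] at h0
    omega
  refine ⟨Equiv.ofBijective τ (Finite.injective_iff_bijective.mp hinj), fun i ↦ f (Pi.single i 1) (τ i), fun i ↦ (hτ i).1,
    fun a i ↦ ?_⟩
  rw [Equiv.ofBijective_apply, LinearMap.pi_apply_eq_sum_univ f a, Finset.sum_apply,
    Finset.sum_eq_single i (fun k _ hki ↦ ?_) (fun h ↦ absurd (Finset.mem_univ i) h)]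
  · rw [Pi.smul_apply, smul_eq_mul, mul_comm, hsingle i]
  · rw [Pi.smul_apply, smul_eq_mul, hsingle k, (hτ k).2 (τ i) (fun h ↦ hki (hinj h).symm), mul_zero]

/-! ### §2 Proposition 3.3, the two directions -/

/-- **(⇒) Isometric lens spaces have `‖·‖₁`-isometric congruence lattices**: if `p_{σ(i)} ≡ e_ils_i (mod q)` (`e_i = ±1`) and the
`p_i` are prime to `q`, then the signed permutation `φ(a)_{σ(i)} = e_ia_i` is a `ℤ`-linear automorphism of `ℤⁿ` preserving `∑|aᵢ|`
with `a ∈ 𝓛(q; s) ↔ φ(a) ∈ 𝓛(q; p)` ("Hence `𝓛(q, s') = 𝓛(q, φ(s)) = φ(𝓛(q, s))` with `φ` a `‖·‖₁`-isometry"; `∑_jφ(a)_jp_j ≡ l∑_ia_is_i`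
and `l` is prime to `q`). [cite: LauretMiatelloRossetti2015, Proposition 3.3 (proof, first part)] -/
theorem LensWeightsEquivalent.exists_linearEquiv_oneNorm {n : ℕ} {q : ℕ} {p s : Fin n → ℤ} (h : LensWeightsEquivalent q p s)
    (hp : ∀ i, IsCoprime (p i) q) :
    ∃ φ : (Fin n → ℤ) ≃ₗ[ℤ] (Fin n → ℤ), (∀ a, ∑ i, (φ a i).natAbs = ∑ i, (a i).natAbs) ∧
      ∀ a, ((q : ℤ) ∣ ∑ i, a i * s i ↔ (q : ℤ) ∣ ∑ i, φ a i * p i) := by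
  obtain ⟨l, e, he, σ, hσ⟩ := h
  have he2 : ∀ i, e i * e i = 1 := fun i ↦ by rcases he i with h1 | h1 <;> simp [h1]
  -- the signed permutation `φ(a)_j = e_{σ⁻¹ j} a_{σ⁻¹ j}`, an involution up to the permutation
  let φ : (Fin n → ℤ) ≃ₗ[ℤ] (Fin n → ℤ) :=
    { toFun := fun a j ↦ e (σ.symm j) * a (σ.symm j)
      map_add' := fun a b ↦ by
        funext j
        simp only [Pi.add_apply]
        ring
      map_smul' := fun c a ↦ by
        funext j
        simp only [Pi.smul_apply, smul_eq_mul, RingHom.id_apply]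
        ring
      invFun := fun b i ↦ e i * b (σ i)
      left_inv := fun a ↦ by
        funext i
        show e i * (e (σ.symm (σ i)) * a (σ.symm (σ i))) = a i
        rw [Equiv.symm_apply_apply, ← mul_assoc, he2, one_mul]
      right_inv := fun b ↦ by
        funext j
        show e (σ.symm j) * (e (σ.symm j) * b (σ (σ.symm j))) = b j
        rw [Equiv.apply_symm_apply, ← mul_assoc, he2, one_mul] }
  have hφ : ∀ a j, φ a j = e (σ.symm j) * a (σ.symm j) := fun a j ↦ rfl
  refine ⟨φ, fun a ↦ ?_, fun a ↦ ?_⟩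
  · -- one-norm: `∑_j |e_{σ⁻¹j} a_{σ⁻¹j}| = ∑_i |a_i|`
    simp_rw [hφ, Int.natAbs_mul]
    rw [← Equiv.sum_comp σ.symm (fun i ↦ (a i).natAbs)]
    refine Finset.sum_congr rfl fun j _ ↦ ?_
    rcases he (σ.symm j) with h1 | h1 <;> simp [h1]
  · -- lattices: `∑_j φ(a)_j p_j = ∑_i e_i a_i p_{σ i} ≡ l ∑_i a_i s_i`
    have hsum : ∑ j, φ a j * p j = ∑ i, e i * a i * p (σ i) := by
      rw [← Equiv.sum_comp σ (fun j ↦ φ a j * p j)]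
      refine Finset.sum_congr rfl fun i _ ↦ ?_
      rw [hφ, Equiv.symm_apply_apply]
    have hdiff : (q : ℤ) ∣ ∑ i, e i * a i * p (σ i) - l * ∑ i, a i * s i := by
      rw [Finset.mul_sum, ← Finset.sum_sub_distrib]
      refine Finset.dvd_sum fun i _ ↦ ?_
      obtain ⟨m, hm⟩ := (Int.modEq_iff_dvd.mp (hσ i).symm)
      exact ⟨e i * a i * m, by linear_combination (e i * a i) * hm + (l * a i * s i) * he2 i⟩
    rw [hsum]
    rcases Nat.eq_zero_or_pos n with hn | hn
    · subst hn
      simp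
    · -- `l` is prime to `q` (some `p_{σ i₀}` is)
      have hl : IsCoprime l q := by
        set i₀ : Fin n := ⟨0, hn⟩
        obtain ⟨x, y, hxy⟩ := hp (σ i₀)
        obtain ⟨m, hm⟩ := (hσ i₀).symm.dvd
        exact ⟨x * e i₀ * s i₀, x * m + y, by linear_combination hxy - x * hm⟩
      constructor
      · intro h
        have h2 : (q : ℤ) ∣ l * ∑ i, a i * s i := h.mul_left l
        have h3 := dvd_add hdiff h2
        rwa [sub_add_cancel] at h3
      · intro h
        have h2 := dvd_sub h hdiff
        rw [sub_sub_cancel] at h2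
        obtain ⟨c, hc⟩ := h2
        obtain ⟨x, y, hxy⟩ := hl
        exact ⟨x * c + y * ∑ i, a i * s i, by linear_combination (-(∑ i, a i * s i)) * hxy + x * hc⟩

/-- **(⇐) `‖·‖₁`-isometric congruence lattices come from isometric lens spaces** — in fact a one-norm-preserving `ℤ`-linear map
`f` of `ℤⁿ` with `f(𝓛(q; s)) ⊆ 𝓛(q; p)` already forces `LensWeightsEquivalent q p s` when the `s_i` are prime to `q`: `f` is a
signed permutation `f(a)_{σ(i)} = ε_ia_i` (§1); the vectors `s_{i₀}e_j − s_je_{i₀} ∈ 𝓛(q; s)` give `ε_js_{i₀}p_{σ(j)} ≡ ε_{i₀}s_jp_{σ(i₀)}`,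
and with `us_{i₀} ≡ 1`: `p_{σ(j)} ≡ ε_j·(uε_{i₀}p_{σ(i₀)})·s_j (mod q)` ("the vector `(−s'_j, 0, …, 0, s'₁, 0, …, 0)` lies in `𝓛(q; s')`
… if `t ∈ ℤ` is such that `tε_{σ(1)}s_{σ(1)} ≡ s'₁ (mod q)`, one has that `s'_j ≡ tε_{σ(j)}s_{σ(j)} (mod q)` for every `j`").
[cite: LauretMiatelloRossetti2015, Proposition 3.3 (proof, converse)] -/
theorem lensWeightsEquivalent_of_linearMap_oneNorm {n : ℕ} {q : ℕ} {p s : Fin n → ℤ} (hs : ∀ i, IsCoprime (s i) q)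
    (f : (Fin n → ℤ) →ₗ[ℤ] (Fin n → ℤ)) (hf : ∀ a, ∑ i, (f a i).natAbs = ∑ i, (a i).natAbs)
    (hL : ∀ a, (q : ℤ) ∣ ∑ i, a i * s i → (q : ℤ) ∣ ∑ i, f a i * p i) : LensWeightsEquivalent q p s := by
  classical
  obtain ⟨σ, ε, hε, hσ⟩ := exists_perm_sign_of_linearMap_oneNorm_eq f hf
  have hε2 : ∀ i, ε i * ε i = 1 := fun i ↦ by rcases hε i with h1 | h1 <;> simp [h1]
  rcases Nat.eq_zero_or_pos n with hn | hn
  · subst hn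
    exact ⟨1, fun _ ↦ 1, fun i ↦ i.elim0, Equiv.refl _, fun i ↦ i.elim0⟩
  set i₀ : Fin n := ⟨0, hn⟩
  -- `∑_j f(a)_j p_j = ∑_i ε_i a_i p_{σ i}`
  have hfsum : ∀ a, ∑ j, f a j * p j = ∑ i, ε i * a i * p (σ i) := fun a ↦ by
    rw [← Equiv.sum_comp σ (fun j ↦ f a j * p j)]
    exact Finset.sum_congr rfl fun i _ ↦ by rw [hσ a i]
  -- LMR's vectors `a = s_{i₀} e_j − s_j e_{i₀} ∈ 𝓛(q; s)`
  have hrel : ∀ j, (q : ℤ) ∣ ε j * s i₀ * p (σ j) - ε i₀ * s j * p (σ i₀) := by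
    intro j
    by_cases hj : j = i₀
    · subst hj
      simp
    set a : Fin n → ℤ := Pi.single j (s i₀) - Pi.single i₀ (s j) with ha
    have hpt : ∀ (g : Fin n → ℤ), ∑ i, a i * g i = s i₀ * g j - s j * g i₀ := by
      intro g
      simp only [ha, Pi.sub_apply, sub_mul, Finset.sum_sub_distrib]
      congr 1
      · rw [Finset.sum_eq_single j (fun i _ hi ↦ by rw [Pi.single_eq_of_ne hi, zero_mul])
          (fun h ↦ absurd (Finset.mem_univ j) h), Pi.single_eq_same]
      · rw [Finset.sum_eq_single i₀ (fun i _ hi ↦ by rw [Pi.single_eq_of_ne hi, zero_mul])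
          (fun h ↦ absurd (Finset.mem_univ i₀) h), Pi.single_eq_same]
    have hin : (q : ℤ) ∣ ∑ i, a i * s i := by
      rw [hpt]
      exact ⟨0, by ring⟩
    have hout := hL a hin
    rw [hfsum, show (∑ i, ε i * a i * p (σ i)) = ∑ i, a i * (ε i * p (σ i)) from
      Finset.sum_congr rfl fun i _ ↦ by ring, hpt] at hout
    obtain ⟨m, hm⟩ := hout
    exact ⟨m, by linear_combination hm⟩
  -- `u s_{i₀} ≡ 1`; then `l = u ε_{i₀} p_{σ i₀}`
  obtain ⟨u, v, huv⟩ := hs i₀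
  refine ⟨u * ε i₀ * p (σ i₀), ε, hε, σ, fun j ↦ ?_⟩
  obtain ⟨m, hm⟩ := hrel j
  apply Int.ModEq.symm
  rw [Int.modEq_iff_dvd]
  exact ⟨u * ε j * m + v * p (σ j), by
    linear_combination (u * ε j) * hm - p (σ j) * huv - (u * s i₀ * p (σ j)) * hε2 j⟩

/-! ### §3 PROPOSITION 3.3 and the one-norm counts -/

/-- **PROPOSITION 3.3 (Lauret–Miatello–Rossetti): "`L(q; s)` and `L(q; s')` are isometric if and only if `𝓛(q; s)` and `𝓛(q; s')` are
`‖·‖₁`-isometric."** For weight families `p, s : Fin n → ℤ` prime to `q`: Ikeda's isometry criterion `LensWeightsEquivalent q p s`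
(`p_{σ(i)} ≡ e_ils_i`) holds iff there is a `ℤ`-linear automorphism `φ` of `ℤⁿ` preserving `∑|aᵢ|` with `a ∈ 𝓛(q; s) ↔ φ(a) ∈ 𝓛(q; p)`
for all `a`. [cite: LauretMiatelloRossetti2015, Proposition 3.3] -/
theorem lensWeightsEquivalent_iff_exists_linearEquiv_oneNorm {n : ℕ} {q : ℕ} {p s : Fin n → ℤ} (hp : ∀ i, IsCoprime (p i) q)
    (hs : ∀ i, IsCoprime (s i) q) :
    LensWeightsEquivalent q p s ↔ ∃ φ : (Fin n → ℤ) ≃ₗ[ℤ] (Fin n → ℤ), (∀ a, ∑ i, (φ a i).natAbs = ∑ i, (a i).natAbs) ∧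
      ∀ a, ((q : ℤ) ∣ ∑ i, a i * s i ↔ (q : ℤ) ∣ ∑ i, φ a i * p i) :=
  ⟨fun h ↦ h.exists_linearEquiv_oneNorm hp,
    fun ⟨φ, hφ, hL⟩ ↦ lensWeightsEquivalent_of_linearMap_oneNorm hs φ.toLinearMap hφ fun a ↦ (hL a).mp⟩

/-- **`‖·‖₁`-isometric congruence lattices are `‖·‖₁`-isospectral**: a one-norm-preserving automorphism `φ` of `ℤⁿ` with `a ∈ 𝓛(q; s)
↔ φ(a) ∈ 𝓛(q'; p)` restricts to bijections of the one-norm shells, so `N_{𝓛(q;s)}(k) = N_{𝓛(q';p)}(k)` for every `k` (the counts of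
row g47-#1: `#{μ ∈ [−k, k]ⁿ : ∑|μᵢ| = k ∧ q ∣ ∑μᵢsᵢ}`); with Proposition 3.3 and `HigherLensSpaceOneNormLattice.lean` this is the
lattice form of "isometric lens spaces are isospectral". [cite: LauretMiatelloRossetti2015, Definition 3.2 and Proposition 3.3] -/
theorem card_oneNorm_congruenceLattice_eq_of_linearEquiv {n : ℕ} {q q' : ℕ} {p s : Fin n → ℤ}
    (φ : (Fin n → ℤ) ≃ₗ[ℤ] (Fin n → ℤ)) (hφ : ∀ a, ∑ i, (φ a i).natAbs = ∑ i, (a i).natAbs)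
    (hL : ∀ a, ((q : ℤ) ∣ ∑ i, a i * s i ↔ (q' : ℤ) ∣ ∑ i, φ a i * p i)) (k : ℕ) :
    ((Fintype.piFinset fun _ : Fin n ↦ Finset.Icc (-(k : ℤ)) (k : ℤ)).filter
        (fun μ ↦ ∑ i, (μ i).natAbs = k ∧ (q : ℤ) ∣ ∑ i, μ i * s i)).card =
      ((Fintype.piFinset fun _ : Fin n ↦ Finset.Icc (-(k : ℤ)) (k : ℤ)).filter
        (fun μ ↦ ∑ i, (μ i).natAbs = k ∧ (q' : ℤ) ∣ ∑ i, μ i * p i)).card := by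
  classical
  -- a vector of one-norm `k` lies in the box `[−k, k]ⁿ`
  have hbox : ∀ (μ : Fin n → ℤ), ∑ i, (μ i).natAbs = k → ∀ i, -(k : ℤ) ≤ μ i ∧ μ i ≤ k := by
    intro μ hμ i
    have hi : (μ i).natAbs ≤ ∑ j, (μ j).natAbs :=
      Finset.single_le_sum (f := fun j ↦ (μ j).natAbs) (fun j _ ↦ Nat.zero_le _) (Finset.mem_univ i)
    omega
  refine Finset.card_bij' (fun μ _ ↦ φ μ) (fun ν _ ↦ φ.symm ν) (fun μ hμ ↦ ?_) (fun ν hν ↦ ?_)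
    (fun μ _ ↦ φ.symm_apply_apply μ) (fun ν _ ↦ φ.apply_symm_apply ν)
  · simp only [Finset.mem_filter, Fintype.mem_piFinset, Finset.mem_Icc] at hμ ⊢
    obtain ⟨-, hk, hdvd⟩ := hμ
    have hk' : ∑ i, (φ μ i).natAbs = k := by rw [hφ, hk]
    exact ⟨hbox _ hk', hk', (hL μ).mp hdvd⟩
  · simp only [Finset.mem_filter, Fintype.mem_piFinset, Finset.mem_Icc] at hν ⊢
    obtain ⟨-, hk, hdvd⟩ := hν
    have hk' : ∑ i, (φ.symm ν i).natAbs = k := by rw [← hφ (φ.symm ν), LinearEquiv.apply_symm_apply, hk]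
    refine ⟨hbox _ hk', hk', (hL (φ.symm ν)).mpr ?_⟩
    simpa only [LinearEquiv.apply_symm_apply] using hdvd

end Literature.Analysis.InnerProduct
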